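import Mathlib
import HarnessLib
import Literature.Analysis.Distribution.ExpTailSharpBound

/-!
# Finite exponential sums: the kernel inequalities behind the instrument constants `M₁`, `C` and the tail of `M(r)`

Cell `ns-blowup`, seat `instab2` (g8). Companion of `ABCSkeletonPersistenceNewton` §4 (p453189), which proved the
ONE-MODE Taylor remainder `‖e^{i⟨k,y⟩} − Σ_{l≤N}(i⟨k,y⟩)^l/l!‖ ≤ (|k||y|)^{N+1}/(N+1)!` on `EuclideanSpace ℝ (Fin 3)`.
Here the estimate is SUMMED over a finite family of modes, for exponential sums with coefficients in an arbitrary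
complex normed space `W` over an arbitrary real inner-product space `E`:

  `f(x) = Σ_{j ∈ s} e^{i⟨k_j, x⟩} a_j`,  `k_j ∈ E`, `a_j ∈ W`.

Proved (all elementary: `|e^{it}| = 1`, the triangle inequality over `s`, Durrett's bound per mode, the chain rule):
* §1 one mode: `|e^{i⟨k,x⟩}| = 1`, phase splitting, the remainder for general `E`, `‖e^{i⟨k,x⟩} − e^{i⟨k,x'⟩}‖ ≤ |k||x − x'|`;
* §2 sums: `‖f(x)‖ ≤ Σ‖a_j‖`; the SUMMED TAYLOR REMAINDER
  `‖f(p + y) − Σ_j e^{i⟨k_j,p⟩}(Σ_{l≤m}(i⟨k_j,y⟩)^l/l!) a_j‖ ≤ |y|^{m+1}/(m+1)! · Σ_j |k_j|^{m+1}‖a_j‖` for every `m`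
  (`norm_sum_exp_smul_sub_taylor_le`); `m = 0`: `f` is Lipschitz with constant `Σ_j |k_j|‖a_j‖`;
* §3 the derivative: `f` is (real-)differentiable with `Df(x) = Σ_j e^{i⟨k_j,x⟩} B_j`, `B_j y = i⟨k_j,y⟩ a_j` — AGAIN an
  exponential sum, with coefficients `B_j ∈ (E →L[ℝ] W)`, `‖B_j‖ ≤ |k_j|‖a_j‖`; hence `‖Df(x)‖ ≤ Σ|k_j|‖a_j‖`,
  `‖Df(x) − Df(x')‖ ≤ (Σ_j |k_j|²‖a_j‖)|x − x'|`, and the summed Taylor remainder of `Df` with weights `Σ_j |k_j|^{m+2}‖a_j‖`.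

Dictionary to the instruments (`HOME/instab2/CERTIFICATE-G2.md` §3): a velocity snapshot's perturbation field is
`G(x) = Σ_k Ĝ_k e^{ik·x}` (`E = EuclideanSpace ℝ (Fin 3)`, `W = ℂ³ ⊇ ℝ³` isometrically, `a_k = Ĝ_k`), `∇G = DG` is the
exponential sum with coefficients `ik ⊗ Ĝ_k = B_k`; so `Σ_k |k|²|Ĝ_k|` IS a radial/global Lipschitz constant of `∇G`
(`skeleton_persist` v1.1's `M₁`, `skeleton_count`'s `C ≥ sup‖∇²G‖` in the form it is used), and the order-`m` tail of
`skeleton_persist` v1.2's `M(r)` is `r^m Σ_k |k|^{m+2}|Ĝ_k|/(m+1)!` — `norm_fderivSum_sub_taylor_le` divided by `|y| ≤ r`.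
WHAT IS NOT HERE: the Cauchy–Schwarz bound of the polynomial (derivative-tensor) terms by Frobenius norms and the
float64 evaluation of the sums — those stay on the instrument's side (certificate caveat (i)). No definitions.
WHAT THIS IS NOT: not Navier–Stokes; calculus on trigonometric polynomials.
-/

noncomputable section

open Complex

namespace Summit.NavierStokesRegularity.FluidComputer.ExpSumTaylorBound

variable {E : Type*} [NormedAddCommGroup E] [InnerProductSpace ℝ E]
variable {W : Type*} [NormedAddCommGroup W] [NormedSpace ℂ W]
variable {ι : Type*}

/-! ## §1 One mode -/

/-- A Fourier mode has modulus one: `‖e^{i⟨k,x⟩}‖ = 1`. -/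
theorem norm_exp_inner_mul_I (k x : E) : ‖cexp (((inner ℝ k x : ℝ) : ℂ) * I)‖ = 1 :=
  Complex.norm_exp_ofReal_mul_I _

/-- Phase splitting: `e^{i⟨k, p + y⟩} = e^{i⟨k,p⟩} e^{i⟨k,y⟩}`. -/
theorem exp_inner_add_mul_I (k p y : E) :
    cexp (((inner ℝ k (p + y) : ℝ) : ℂ) * I) =
      cexp (((inner ℝ k p : ℝ) : ℂ) * I) * cexp (((inner ℝ k y : ℝ) : ℂ) * I) := by
  rw [inner_add_right, Complex.ofReal_add, add_mul, Complex.exp_add]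

/-- **Taylor remainder of a single Fourier mode** (general real inner-product space): for every order `N`,
`‖e^{i⟨k,y⟩} − Σ_{l ≤ N} (i⟨k,y⟩)^l/l!‖ ≤ (|k||y|)^{N+1}/(N+1)!` — Durrett's one-variable bound
`Literature.Analysis.Distribution.norm_exp_mul_I_sub_sum_le` at `t = ⟨k,y⟩` and Cauchy–Schwarz `|⟨k,y⟩| ≤ |k||y|`
(the `EuclideanSpace ℝ (Fin 3)` case is `ABCSkeletonPersistenceNewton.norm_exp_inner_mul_I_sub_sum_le`, p453189). -/
theorem norm_exp_inner_mul_I_sub_sum_le (k y : E) (N : ℕ) :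
    ‖cexp (((inner ℝ k y : ℝ) : ℂ) * I) -
        ∑ l ∈ Finset.range (N + 1), (((inner ℝ k y : ℝ) : ℂ) * I) ^ l / (Nat.factorial l : ℂ)‖ ≤
      (‖k‖ * ‖y‖) ^ (N + 1) / (Nat.factorial (N + 1) : ℝ) := by
  have h := Literature.Analysis.Distribution.norm_exp_mul_I_sub_sum_le N (inner ℝ k y)
  have hcs : |inner ℝ k y| ≤ ‖k‖ * ‖y‖ := abs_real_inner_le_norm k y
  have hpow : |inner ℝ k y| ^ (N + 1) ≤ (‖k‖ * ‖y‖) ^ (N + 1) :=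
    pow_le_pow_left₀ (abs_nonneg _) hcs (N + 1)
  have hfac : (0 : ℝ) < (Nat.factorial (N + 1) : ℝ) := by exact_mod_cast Nat.factorial_pos _
  exact h.trans (div_le_div_of_nonneg_right hpow hfac.le)

/-- Order zero: `‖e^{i⟨k,y⟩} − 1‖ ≤ |k||y|`. -/
theorem norm_exp_inner_mul_I_sub_one_le (k y : E) :
    ‖cexp (((inner ℝ k y : ℝ) : ℂ) * I) - 1‖ ≤ ‖k‖ * ‖y‖ := by
  simpa using norm_exp_inner_mul_I_sub_sum_le k y 0

/-- A Fourier mode is `|k|`-Lipschitz: `‖e^{i⟨k,x⟩} − e^{i⟨k,x'⟩}‖ ≤ |k||x − x'|`. -/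
theorem norm_exp_inner_mul_I_sub_exp_inner_mul_I_le (k x x' : E) :
    ‖cexp (((inner ℝ k x : ℝ) : ℂ) * I) - cexp (((inner ℝ k x' : ℝ) : ℂ) * I)‖ ≤ ‖k‖ * ‖x - x'‖ := by
  have hx : x = x' + (x - x') := by abel
  calc ‖cexp (((inner ℝ k x : ℝ) : ℂ) * I) - cexp (((inner ℝ k x' : ℝ) : ℂ) * I)‖
      = ‖cexp (((inner ℝ k x' : ℝ) : ℂ) * I) * (cexp (((inner ℝ k (x - x') : ℝ) : ℂ) * I) - 1)‖ := by
        rw [mul_sub, mul_one, ← exp_inner_add_mul_I, ← hx]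
    _ ≤ ‖k‖ * ‖x - x'‖ := by
        rw [norm_mul, norm_exp_inner_mul_I, one_mul]
        exact norm_exp_inner_mul_I_sub_one_le k (x - x')

/-! ## §2 Finite exponential sums: size, and the summed Taylor remainder -/

/-- `‖Σ_j e^{i⟨k_j,x⟩} a_j‖ ≤ Σ_j ‖a_j‖` (triangle inequality; every phase has modulus one). -/
theorem norm_sum_exp_smul_le (s : Finset ι) (k : ι → E) (a : ι → W) (x : E) :
    ‖∑ j ∈ s, cexp (((inner ℝ (k j) x : ℝ) : ℂ) * I) • a j‖ ≤ ∑ j ∈ s, ‖a j‖ := by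
  refine (norm_sum_le _ _).trans (le_of_eq (Finset.sum_congr rfl fun j _ => ?_))
  rw [norm_smul, norm_exp_inner_mul_I, one_mul]

/-- **Summed Taylor remainder of a finite exponential sum.** For `f(x) = Σ_{j∈s} e^{i⟨k_j,x⟩} a_j`, every base
point `p`, increment `y` and order `m`:
`‖f(p + y) − Σ_j e^{i⟨k_j,p⟩} (Σ_{l ≤ m} (i⟨k_j,y⟩)^l/l!) a_j‖ ≤ |y|^{m+1}/(m+1)! · Σ_j |k_j|^{m+1} ‖a_j‖`.
The subtracted sum is `f`'s order-`m` Taylor polynomial at `p` written mode by mode (its `l = 0` part is `f(p)`;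
its order-`l` part is `(1/l!) D^l f(p)[y,…,y]`). Proof: phase splitting, triangle inequality over `s`, `|e^{i⟨k_j,p⟩}| = 1`,
and the one-mode remainder. This is the tail term of `skeleton_persist` v1.2's radial bound `M(r)`
(`HOME/instab2/CERTIFICATE-G2.md` §3), for an arbitrary coefficient space. -/
theorem norm_sum_exp_smul_sub_taylor_le (s : Finset ι) (k : ι → E) (a : ι → W) (p y : E) (m : ℕ) :
    ‖∑ j ∈ s, cexp (((inner ℝ (k j) (p + y) : ℝ) : ℂ) * I) • a j -
        ∑ j ∈ s, (cexp (((inner ℝ (k j) p : ℝ) : ℂ) * I) *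
          ∑ l ∈ Finset.range (m + 1), (((inner ℝ (k j) y : ℝ) : ℂ) * I) ^ l / (Nat.factorial l : ℂ)) • a j‖ ≤
      ‖y‖ ^ (m + 1) / (Nat.factorial (m + 1) : ℝ) * ∑ j ∈ s, ‖k j‖ ^ (m + 1) * ‖a j‖ := by
  rw [← Finset.sum_sub_distrib, Finset.mul_sum]
  refine (norm_sum_le _ _).trans (Finset.sum_le_sum fun j _ => ?_)
  rw [← sub_smul, exp_inner_add_mul_I, ← mul_sub, norm_smul, norm_mul, norm_exp_inner_mul_I, one_mul]
  calc ‖cexp (((inner ℝ (k j) y : ℝ) : ℂ) * I) -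
          ∑ l ∈ Finset.range (m + 1), (((inner ℝ (k j) y : ℝ) : ℂ) * I) ^ l / (Nat.factorial l : ℂ)‖ * ‖a j‖
      ≤ (‖k j‖ * ‖y‖) ^ (m + 1) / (Nat.factorial (m + 1) : ℝ) * ‖a j‖ := by
        gcongr
        exact norm_exp_inner_mul_I_sub_sum_le (k j) y m
    _ = ‖y‖ ^ (m + 1) / (Nat.factorial (m + 1) : ℝ) * (‖k j‖ ^ (m + 1) * ‖a j‖) := by
        rw [mul_pow]; ring

/-- Order zero of the summed remainder: `‖f(p + y) − f(p)‖ ≤ |y| · Σ_j |k_j| ‖a_j‖`. -/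
theorem norm_sum_exp_smul_add_sub_le (s : Finset ι) (k : ι → E) (a : ι → W) (p y : E) :
    ‖∑ j ∈ s, cexp (((inner ℝ (k j) (p + y) : ℝ) : ℂ) * I) • a j -
        ∑ j ∈ s, cexp (((inner ℝ (k j) p : ℝ) : ℂ) * I) • a j‖ ≤
      ‖y‖ * ∑ j ∈ s, ‖k j‖ * ‖a j‖ := by
  have h := norm_sum_exp_smul_sub_taylor_le s k a p y 0
  simpa using h

/-- **A finite exponential sum is Lipschitz with constant `Σ_j |k_j| ‖a_j‖`**:
`‖f(x) − f(x')‖ ≤ (Σ_j |k_j| ‖a_j‖) |x − x'|` for all `x, x'`. -/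
theorem norm_sum_exp_smul_sub_sum_exp_smul_le (s : Finset ι) (k : ι → E) (a : ι → W) (x x' : E) :
    ‖∑ j ∈ s, cexp (((inner ℝ (k j) x : ℝ) : ℂ) * I) • a j -
        ∑ j ∈ s, cexp (((inner ℝ (k j) x' : ℝ) : ℂ) * I) • a j‖ ≤
      (∑ j ∈ s, ‖k j‖ * ‖a j‖) * ‖x - x'‖ := by
  have h := norm_sum_exp_smul_add_sub_le s k a x' (x - x')
  rw [add_sub_cancel, mul_comm] at h
  exact h

/-! ## §3 The derivative of an exponential sum is an exponential sum -/

/-- The coefficient map of the derivative of one mode, `B(k,a) : y ↦ i⟨k,y⟩ a`, written as the continuous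
`ℝ`-linear map `(i · (ofReal ∘ ⟨k,·⟩)).smulRight a`, acts as stated. -/
theorem smulRight_inner_apply (k : E) (a : W) (y : E) :
    ((I • (Complex.ofRealCLM.comp (innerSL ℝ k))).smulRight a) y = ((((inner ℝ k y : ℝ) : ℂ)) * I) • a := by
  simp [ContinuousLinearMap.smulRight_apply, innerSL_apply_apply, mul_comm]

/-- `‖B(k,a)‖ ≤ |k| ‖a‖` for the derivative coefficient map `B(k,a) y = i⟨k,y⟩ a`. -/
theorem norm_smulRight_inner_le (k : E) (a : W) :
    ‖(I • (Complex.ofRealCLM.comp (innerSL ℝ k))).smulRight a‖ ≤ ‖k‖ * ‖a‖ := by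
  refine ContinuousLinearMap.opNorm_le_bound _ (by positivity) fun y => ?_
  rw [smulRight_inner_apply, norm_smul, norm_mul, Complex.norm_real, Complex.norm_I, mul_one,
    Real.norm_eq_abs]
  calc |inner ℝ k y| * ‖a‖ ≤ ‖k‖ * ‖y‖ * ‖a‖ := by
        gcongr; exact abs_real_inner_le_norm k y
    _ = ‖k‖ * ‖a‖ * ‖y‖ := by ring

/-- **One Fourier mode is differentiable**, with derivative `e^{i⟨k,x⟩} B(k,a)`:
`D(e^{i⟨k,·⟩} a)(x) y = e^{i⟨k,x⟩} i⟨k,y⟩ a` (chain rule: `⟨k,·⟩` is linear, `exp' = exp`). -/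
theorem hasFDerivAt_exp_inner_smul (k : E) (a : W) (x : E) :
    HasFDerivAt (fun z : E => cexp (((inner ℝ k z : ℝ) : ℂ) * I) • a)
      (cexp (((inner ℝ k x : ℝ) : ℂ) * I) • (I • (Complex.ofRealCLM.comp (innerSL ℝ k))).smulRight a) x := by
  -- the phase `u(z) = ⟨k,z⟩ · i` and its derivative
  have hu : HasFDerivAt (fun z : E => ((inner ℝ k z : ℝ) : ℂ) * I)
      (I • (Complex.ofRealCLM.comp (innerSL ℝ k))) x := by
    have h1 : HasFDerivAt (fun z : E => ((inner ℝ k z : ℝ) : ℂ)) (Complex.ofRealCLM.comp (innerSL ℝ k)) x := by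
      have := (Complex.ofRealCLM.comp (innerSL ℝ k)).hasFDerivAt (x := x)
      convert this using 1
      ext z
      simp [innerSL_apply_apply]
    exact h1.mul_const I
  have hexp : HasFDerivAt (fun z : E => cexp (((inner ℝ k z : ℝ) : ℂ) * I))
      (cexp (((inner ℝ k x : ℝ) : ℂ) * I) • (I • (Complex.ofRealCLM.comp (innerSL ℝ k)))) x :=
    (Complex.hasDerivAt_exp _).comp_hasFDerivAt x hu
  have h := hexp.smul_const a
  convert h using 1
  ext y
  simp [ContinuousLinearMap.smulRight_apply, smul_smul, mul_assoc]

/-- **A finite exponential sum is differentiable and its derivative is the exponential sum of the coefficient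
maps**: `Df(x) = Σ_j e^{i⟨k_j,x⟩} B(k_j,a_j)`, i.e. `Df(x) y = Σ_j e^{i⟨k_j,x⟩} i⟨k_j,y⟩ a_j`. -/
theorem hasFDerivAt_sum_exp_smul (s : Finset ι) (k : ι → E) (a : ι → W) (x : E) :
    HasFDerivAt (fun z : E => ∑ j ∈ s, cexp (((inner ℝ (k j) z : ℝ) : ℂ) * I) • a j)
      (∑ j ∈ s, cexp (((inner ℝ (k j) x : ℝ) : ℂ) * I) •
        (I • (Complex.ofRealCLM.comp (innerSL ℝ (k j)))).smulRight (a j)) x :=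
  HasFDerivAt.fun_sum fun j _ => hasFDerivAt_exp_inner_smul (k j) (a j) x


/-- Hence a finite exponential sum is differentiable (over `ℝ`) everywhere. -/
theorem differentiable_sum_exp_smul (s : Finset ι) (k : ι → E) (a : ι → W) :
    Differentiable ℝ (fun z : E => ∑ j ∈ s, cexp (((inner ℝ (k j) z : ℝ) : ℂ) * I) • a j) :=
  fun x => (hasFDerivAt_sum_exp_smul s k a x).differentiableAt

/-- `fderiv` form of the derivative: `fderiv ℝ f x = Σ_j e^{i⟨k_j,x⟩} B(k_j,a_j)`. -/
theorem fderiv_sum_exp_smul (s : Finset ι) (k : ι → E) (a : ι → W) (x : E) :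
    fderiv ℝ (fun z : E => ∑ j ∈ s, cexp (((inner ℝ (k j) z : ℝ) : ℂ) * I) • a j) x =
      ∑ j ∈ s, cexp (((inner ℝ (k j) x : ℝ) : ℂ) * I) •
        (I • (Complex.ofRealCLM.comp (innerSL ℝ (k j)))).smulRight (a j) :=
  (hasFDerivAt_sum_exp_smul s k a x).fderiv

/-- The derivative sum acts by `Df(x) y = Σ_j (e^{i⟨k_j,x⟩} i⟨k_j,y⟩) a_j`. -/
theorem sum_exp_smul_smulRight_apply (s : Finset ι) (k : ι → E) (a : ι → W) (x y : E) :
    (∑ j ∈ s, cexp (((inner ℝ (k j) x : ℝ) : ℂ) * I) •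
        (I • (Complex.ofRealCLM.comp (innerSL ℝ (k j)))).smulRight (a j)) y =
      ∑ j ∈ s, (cexp (((inner ℝ (k j) x : ℝ) : ℂ) * I) * ((((inner ℝ (k j) y : ℝ) : ℂ)) * I)) • a j := by
  simp only [FunLike.coe_sum, FunLike.coe_smul, Finset.sum_apply, Pi.smul_apply,
    smulRight_inner_apply, smul_smul]

/-- **Gradient size**: `‖Df(x)‖ ≤ Σ_j |k_j| ‖a_j‖` (the Lipschitz constant of §2 as an operator-norm bound). -/
theorem norm_fderivSum_le (s : Finset ι) (k : ι → E) (a : ι → W) (x : E) :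
    ‖∑ j ∈ s, cexp (((inner ℝ (k j) x : ℝ) : ℂ) * I) •
        (I • (Complex.ofRealCLM.comp (innerSL ℝ (k j)))).smulRight (a j)‖ ≤ ∑ j ∈ s, ‖k j‖ * ‖a j‖ :=
  (norm_sum_exp_smul_le s k _ x).trans (Finset.sum_le_sum fun j _ => norm_smulRight_inner_le (k j) (a j))

/-- **The gradient of a finite exponential sum is Lipschitz with constant `Σ_j |k_j|² ‖a_j‖`**:
`‖Df(x) − Df(x')‖ ≤ (Σ_j |k_j|² ‖a_j‖) |x − x'|` — the constant `M₁ = Σ_k |k|²|Ĝ_k|` of `skeleton_persist` v1.1 and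
`C` of `skeleton_count` (there `f = G`, `a_k = Ĝ_k`, `Df = ∇G`). -/
theorem norm_fderivSum_sub_fderivSum_le (s : Finset ι) (k : ι → E) (a : ι → W) (x x' : E) :
    ‖∑ j ∈ s, cexp (((inner ℝ (k j) x : ℝ) : ℂ) * I) •
          (I • (Complex.ofRealCLM.comp (innerSL ℝ (k j)))).smulRight (a j) -
        ∑ j ∈ s, cexp (((inner ℝ (k j) x' : ℝ) : ℂ) * I) •
          (I • (Complex.ofRealCLM.comp (innerSL ℝ (k j)))).smulRight (a j)‖ ≤
      (∑ j ∈ s, ‖k j‖ ^ 2 * ‖a j‖) * ‖x - x'‖ := by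
  refine (norm_sum_exp_smul_sub_sum_exp_smul_le s k _ x x').trans
    (mul_le_mul_of_nonneg_right (Finset.sum_le_sum fun j _ => ?_) (norm_nonneg _))
  calc ‖k j‖ * ‖(I • (Complex.ofRealCLM.comp (innerSL ℝ (k j)))).smulRight (a j)‖
      ≤ ‖k j‖ * (‖k j‖ * ‖a j‖) := by gcongr; exact norm_smulRight_inner_le (k j) (a j)
    _ = ‖k j‖ ^ 2 * ‖a j‖ := by ring

/-- **Radial form** (the quotient the instrument bounds): for `y ≠ 0`,
`‖Df(p + y) − Df(p)‖ / |y| ≤ Σ_j |k_j|² ‖a_j‖`. -/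
theorem norm_fderivSum_sub_fderivSum_div_le (s : Finset ι) (k : ι → E) (a : ι → W) (p y : E) (hy : y ≠ 0) :
    ‖∑ j ∈ s, cexp (((inner ℝ (k j) (p + y) : ℝ) : ℂ) * I) •
          (I • (Complex.ofRealCLM.comp (innerSL ℝ (k j)))).smulRight (a j) -
        ∑ j ∈ s, cexp (((inner ℝ (k j) p : ℝ) : ℂ) * I) •
          (I • (Complex.ofRealCLM.comp (innerSL ℝ (k j)))).smulRight (a j)‖ / ‖y‖ ≤
      ∑ j ∈ s, ‖k j‖ ^ 2 * ‖a j‖ := by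
  rw [div_le_iff₀ (norm_pos_iff.mpr hy)]
  have h := norm_fderivSum_sub_fderivSum_le s k a (p + y) p
  rwa [add_sub_cancel_left] at h

/-- **Summed Taylor remainder of the gradient** (the tail of `skeleton_persist` v1.2's `M(r)`): for every order `m`,
`‖Df(p + y) − Σ_j e^{i⟨k_j,p⟩} (Σ_{l ≤ m} (i⟨k_j,y⟩)^l/l!) B(k_j,a_j)‖ ≤ |y|^{m+1}/(m+1)! · Σ_j |k_j|^{m+2} ‖a_j‖`
(§2 applied to the exponential sum `Df` with coefficients `B(k_j,a_j)`, then `‖B(k_j,a_j)‖ ≤ |k_j|‖a_j‖`).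
With `|y| ≤ r` the right side divided by `|y|` is at most `r^m Σ_j |k_j|^{m+2}‖a_j‖/(m+1)!`. -/
theorem norm_fderivSum_sub_taylor_le (s : Finset ι) (k : ι → E) (a : ι → W) (p y : E) (m : ℕ) :
    ‖∑ j ∈ s, cexp (((inner ℝ (k j) (p + y) : ℝ) : ℂ) * I) •
          (I • (Complex.ofRealCLM.comp (innerSL ℝ (k j)))).smulRight (a j) -
        ∑ j ∈ s, (cexp (((inner ℝ (k j) p : ℝ) : ℂ) * I) *
          ∑ l ∈ Finset.range (m + 1), (((inner ℝ (k j) y : ℝ) : ℂ) * I) ^ l / (Nat.factorial l : ℂ)) •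
          (I • (Complex.ofRealCLM.comp (innerSL ℝ (k j)))).smulRight (a j)‖ ≤
      ‖y‖ ^ (m + 1) / (Nat.factorial (m + 1) : ℝ) * ∑ j ∈ s, ‖k j‖ ^ (m + 2) * ‖a j‖ := by
  refine (norm_sum_exp_smul_sub_taylor_le s k _ p y m).trans
    (mul_le_mul_of_nonneg_left (Finset.sum_le_sum fun j _ => ?_) (by positivity))
  calc ‖k j‖ ^ (m + 1) * ‖(I • (Complex.ofRealCLM.comp (innerSL ℝ (k j)))).smulRight (a j)‖
      ≤ ‖k j‖ ^ (m + 1) * (‖k j‖ * ‖a j‖) := by gcongr; exact norm_smulRight_inner_le (k j) (a j)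
    _ = ‖k j‖ ^ (m + 2) * ‖a j‖ := by ring

/-- `fderiv` form of the gradient-Lipschitz bound (the shape of hypothesis `hlipG` of the persistence theorems
`ABCSkeletonPersistenceLocal.exists_unique_zero_near_of_abc_eq_zero_local*` /
`ABCSkeletonPersistenceNewton.*`, there for a real field): for `f(x) = Σ_j e^{i⟨k_j,x⟩} a_j` and all `x, x₀`,
`‖fderiv ℝ f x − fderiv ℝ f x₀‖ ≤ (Σ_j |k_j|² ‖a_j‖) |x − x₀|`. -/
theorem norm_fderiv_sub_fderiv_le (s : Finset ι) (k : ι → E) (a : ι → W) (x x₀ : E) :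
    ‖fderiv ℝ (fun z : E => ∑ j ∈ s, cexp (((inner ℝ (k j) z : ℝ) : ℂ) * I) • a j) x -
        fderiv ℝ (fun z : E => ∑ j ∈ s, cexp (((inner ℝ (k j) z : ℝ) : ℂ) * I) • a j) x₀‖ ≤
      (∑ j ∈ s, ‖k j‖ ^ 2 * ‖a j‖) * ‖x - x₀‖ := by
  rw [fderiv_sum_exp_smul, fderiv_sum_exp_smul]
  exact norm_fderivSum_sub_fderivSum_le s k a x x₀

/-- `fderiv` form of the gradient size: `‖fderiv ℝ f x‖ ≤ Σ_j |k_j| ‖a_j‖`. -/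
theorem norm_fderiv_le (s : Finset ι) (k : ι → E) (a : ι → W) (x : E) :
    ‖fderiv ℝ (fun z : E => ∑ j ∈ s, cexp (((inner ℝ (k j) z : ℝ) : ℂ) * I) • a j) x‖ ≤
      ∑ j ∈ s, ‖k j‖ * ‖a j‖ := by
  rw [fderiv_sum_exp_smul]
  exact norm_fderivSum_le s k a x

end Summit.NavierStokesRegularity.FluidComputer.ExpSumTaylorBound
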